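import Literature.MathematicalPhysics.QuantumFieldTheory.Balaban1983to89.B8Prop7ClassAkLiteral
import Literature.MathematicalPhysics.QuantumFieldTheory.Balaban1983to89.B8ConstraintBonds

/-!
# `Balaban1983to89.B8Prop7ClassAkDomainSeq` — [Balaban1985RegularSpaces] Prop. 7 (1.144) p. 100, `𝔄_k`-clause with
# (1.140) in the literal p. 77 convention, FOR AN ADMISSIBLE FAMILY (1.3)/(1.4) in the sense of the tree's record
# `B8ConstraintBonds.DomainSeq`: the nesting hypothesis of `B8Prop7ClassAkLiteral` discharged

statement-level skeleton of published theorems with citation tags; proofs where landed; nothing here is a claim about the Yang–Mills mass gap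

T. Bałaban, *Spaces of regular gauge field configurations on a lattice and gauge fixing conditions*, Commun.
Math. Phys. **99** (1985) 75–102 `[Balaban1985RegularSpaces]` ("B8"; printed page = PDF page + 74).
PDF held: `paper:balaban1985-cmp99-regular-spaces-gauge-fixing` (lit store), p. 77 read as text (`p0003.txt`).
STATUS: published, refereed; this file is a one-screen COROLLARY: `B8Prop7ClassAkLiteral.inAk_mulCfg_literal` takes the
nesting «every side of a plaquette touching `Ω_{i+1}` touches `Ω_i`, `i < k`» as a hypothesis; here it is READ OFF the
tree's ℤᵈ record of (1.3)/(1.4), `B8ConstraintBonds.DomainSeq L Ω` (`sep`: the `ℓ^∞`-ball of radius `L^{n+1}η` about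
a point of `Ω_{n+1}` lies in `Ω_n` — the consequence of «(Lʲη)⁻¹dist(Ω_jᶜ, Ω_{j+1}) > RM₁» (1.4) with `RM₁ ≥ L`),
for `L ≥ 1`.  Nothing here is new mathematics and nothing here is a claim about the Clay problem.

WHAT IS REPRODUCED (lit-balaban SKELETON rows): **B8.Prop7**, `𝔄_k`-clause of (1.144), for a general admissible family
(rows B8.Eq1.3 / B8.Eq1.140 as inputs).  Unit `lit-balaban-p40` (Phase-2 proof seat p40, gen 5, file 6), HOME
`run/shared/lean/pub/lit-balaban/` (owner fold `lit-balaban-r05/ROWS-B8.md`).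

## THE PRINTED TEXT (p. 77 [PDF 3], quoted from the text layer)

«Let us consider a sequence of domains Ω₀ ⊃ Ω₁ ⊃ Ω₂ ⊃ … ⊃ Ω_k, Ω_j ⊂ T_η, (1.3) such that Ω_j = Bʲ(Ω_j^{(j)}), Ω_j is a sum
of cubes of a size M₁Lʲη, (Lʲη)⁻¹dist(Ω_jᶜ, Ω_{j+1}) > RM₁. (1.4) … We assume that R is a sufficiently large positive
integer (a power of L) … If Ω ⊂ T_η, then we denote by Ω also the set of bonds ⋃_{x∈Ω} st(x) = {bonds b ⊂ T_η: at least
one end-point of b belongs to Ω}. Similarly for the corresponding set of plaquettes.»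

## WHAT IS CERTIFIED HERE (kernel; axioms `propext` / `Classical.choice` / `Quot.sound`)

* `corner_mem_of_domainSeq`: under `DomainSeq L Ω`, `L ≥ 1`, every corner of a plaquette touching `Ω_{n+1}` lies in
  `Ω_n`; `sideTouches_succ_bondTouches_of_domainSeq`: `SideTouches (Ω (n+1)) y τ → BondTouches (Ω n) y τ`.
* `cond140_family_of_lit_domainSeq`, **`inAk_mulCfg_literal_domainSeq`**, `inAk_mulCfg_gaugeAct_hermitian_literal_domainSeq`:
  the theorems of `B8Prop7ClassAkLiteral` with the nesting hypothesis replaced by `DomainSeq L Ω` (and `Ω 0 = Set.univ`,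
  the record's model of `Ω₀ = T_η`): `U₁U₀ ∈ 𝔄_k({Ω_j}, α₀ + 3L²α₂)`, `(U₁U₀)^u` likewise for Hermitian `A`.

## HONEST SCOPE — what is NOT claimed

As in `B8Prop7ClassAkLiteral` (constant `α₀ + 3L²α₂` for the literal reading; `Ω₀ = T_η`); the `sat` and `anti` clauses
of `DomainSeq` are not used (only `sep`, and only one lattice layer of it).
-/

namespace Literature.MathematicalPhysics.QuantumFieldTheory.Balaban1983to89.B8Prop7ClassAkDomainSeq

/-! ## The nesting hypothesis of `B8Prop7ClassAkLiteral` DISCHARGED from the tree's (1.3)/(1.4) record `DomainSeq`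

`B8ConstraintBonds.DomainSeq L Ω` is the tree's ℤᵈ record of the admissibility conditions (1.3)/(1.4) p. 77 (`anti`:
«Ω₀ ⊃ Ω₁ ⊃ … ⊃ Ω_k»; `sat`: «Ω_j = Bʲ(Ω_j^{(j)})»; `sep`: the consequence of «(Lʲη)⁻¹dist(Ω_jᶜ, Ω_{j+1}) > RM₁» with
`RM₁ ≥ L` — the `ℓ^∞`-ball of radius `L^{n+1}η` about a point of `Ω_{n+1}` lies in `Ω_n`; there too `Ω₀ = T_η` is
modelled as `Ω 0 = Set.univ`).  Its `sep` clause gives the one-layer nesting used by `cond140_family_of_lit` /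
`inAk_mulCfg_literal`: every corner of a plaquette touching `Ω_{n+1}` lies in `Ω_n` (`L ≥ 1`). -/

open B7Prop1Explicit
open B8Lemma1NonAbelian (mulCfg)
open B8Ineq132 (InAk PlaqTouches BondTouches inAk_gaugeAct_iff)
open B8Eq146AExpansion (expCfg iEta)
open B8Eq140Level (SideTouches Cond140)
open B8Prop7ClassAkLiteral (Cond140Lit cond140_family_of_lit inAk_mulCfg_literal
  inAk_mulCfg_gaugeAct_hermitian_literal)
open B8ConstraintBonds (DomainSeq)

-- `Site` alone would resolve to the torus sites of `Setup.lean`; re-export the `ℤ^d` sites of `B7Prop1Explicit`.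
export B7Prop1Explicit (Site)

variable {d : ℕ}

section DomainSeqNesting

/-- Two corners of a plaquette `p_{κν}(z)`, `κ ≠ ν`, are at `ℓ^∞`-distance `≤ 1`. [folklore] -/
private theorem abs_sub_apply_le_one_of_corners {κ ν : Fin d} (hκν : κ ≠ ν) {z y c : Site d}
    (hy : y = z ∨ y = z + e κ ∨ y = z + e ν ∨ y = z + e κ + e ν)
    (hc : c = z ∨ c = z + e κ ∨ c = z + e ν ∨ c = z + e κ + e ν) (j : Fin d) : |(y - c) j| ≤ 1 := by
  rcases hy with rfl | rfl | rfl | rfl <;> rcases hc with rfl | rfl | rfl | rfl <;>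
    simp only [Pi.sub_apply, Pi.add_apply, e_apply, sub_self, abs_zero, zero_le_one] <;>
    (try split_ifs) <;> (try subst_vars) <;> (rw [abs_le]; constructor <;> omega)

/-- **Under (1.3)/(1.4) (`DomainSeq`) every corner of a plaquette touching `Ω_{n+1}` lies in `Ω_n`** (`L ≥ 1`): the
corner in `Ω_{n+1}` and any other corner differ by a vector with coordinates in `{−1, 0, 1}`, inside the `L^{n+1}`-collar
of `sep`. [cite: Balaban1985RegularSpaces, (1.3)-(1.4) p.77] -/
theorem corner_mem_of_domainSeq {L : ℕ} (hL : 1 ≤ L) {Ω : ℕ → Set (Site d)} (hΩ : DomainSeq L Ω) {n : ℕ}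
    {z : Site d} {κ ν : Fin d} (hκν : κ ≠ ν) (hp : PlaqTouches (Ω (n + 1)) z κ ν) {y : Site d}
    (hy : y = z ∨ y = z + e κ ∨ y = z + e ν ∨ y = z + e κ + e ν) : y ∈ Ω n := by
  obtain ⟨c, hc, hcs⟩ : ∃ c, c ∈ Ω (n + 1) ∧ (c = z ∨ c = z + e κ ∨ c = z + e ν ∨ c = z + e κ + e ν) := by
    rcases hp with h | h | h | h
    exacts [⟨_, h, Or.inl rfl⟩, ⟨_, h, Or.inr (Or.inl rfl)⟩, ⟨_, h, Or.inr (Or.inr (Or.inl rfl))⟩,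
      ⟨_, h, Or.inr (Or.inr (Or.inr rfl))⟩]
  have hL1 : (1 : ℤ) ≤ (L : ℤ) ^ (n + 1) := one_le_pow₀ (by exact_mod_cast hL)
  have h := hΩ.sep n c (y - c) hc fun i => (abs_sub_apply_le_one_of_corners hκν hy hcs i).trans hL1
  simpa using h

/-- **The nesting hypothesis of `cond140_family_of_lit` / `inAk_mulCfg_literal` from (1.3)/(1.4)**: under `DomainSeq L Ω`,
`L ≥ 1`, every side of a plaquette touching `Ω_{n+1}` starts in `Ω_n`, in particular touches `Ω_n` in the p. 77 bond
convention. [cite: Balaban1985RegularSpaces, (1.3)-(1.4) p.77] -/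
theorem sideTouches_succ_bondTouches_of_domainSeq {L : ℕ} (hL : 1 ≤ L) {Ω : ℕ → Set (Site d)}
    (hΩ : DomainSeq L Ω) (n : ℕ) (y : Site d) (τ : Fin d) (hy : SideTouches (Ω (n + 1)) y τ) :
    BondTouches (Ω n) y τ := by
  obtain ⟨z, κ, ν, hκν, hp, hs⟩ := hy
  refine Or.inl (corner_mem_of_domainSeq hL hΩ hκν hp ?_)
  rcases hs with ⟨rfl, -⟩ | ⟨rfl, -⟩ | ⟨rfl, -⟩ | ⟨rfl, -⟩
  exacts [Or.inl rfl, Or.inr (Or.inl rfl), Or.inr (Or.inr (Or.inl rfl)), Or.inl rfl]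

end DomainSeqNesting

section ClassAkDomainSeq

/-- `cond140_family_of_lit` with the nesting read off `DomainSeq`: for an admissible family in the sense of the tree's
(1.3)/(1.4) record with `Ω₀ = T_η`, (1.140) in the literal convention at every level `j ≤ k` gives the enlarged reading
`Cond140 L η (L²α₂) j (Ω j)` at every level `j ≤ k`. [cite: Balaban1985RegularSpaces, (1.140) p.100, (1.3)-(1.4) p.77] -/
theorem cond140_family_of_lit_domainSeq {𝔸 : Type*} [NormedRing 𝔸] [NormedAlgebra ℂ 𝔸] {L : ℕ} (hL : 1 ≤ L)
    {η α₂ : ℝ} (hη : 0 < η) (hα₂ : 0 ≤ α₂) {k : ℕ} {Ω : ℕ → Set (Site d)} (hΩ : DomainSeq L Ω)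
    (hΩ₀ : Ω 0 = Set.univ) {U₀ : Site d → Fin d → 𝔸ˣ} {A : Site d → Fin d → 𝔸}
    (h : ∀ j, j ≤ k → Cond140Lit L η α₂ j (Ω j) U₀ A) (j : ℕ) (hj : j ≤ k) :
    Cond140 L η ((L : ℝ) ^ 2 * α₂) j (Ω j) U₀ A :=
  cond140_family_of_lit hL hη hα₂ hΩ₀ (fun i _ => sideTouches_succ_bondTouches_of_domainSeq hL hΩ i) h j hj

/-- **(1.144), `𝔄_k`-clause, (1.140) IN THE LITERAL CONVENTION, FOR AN ADMISSIBLE FAMILY (1.3)/(1.4)** (`DomainSeq L Ω`,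
`Ω₀ = T_η`): `U₀ ∈ 𝔄_k({Ω_j}, α₀)`, `Cond140Lit` at every level `j ≤ k`, `0 ≤ α₀ ≤ 1/(80d)`, `0 ≤ α₂`, `L²α₂ ≤ 1/(80d)`,
`U₀`, `U₁ = e^{iηA}` `U1`-valued with `|U₁ − 1| ≤ L²α₂(Lʲη)⁻¹η` on `SideTouches (Ω j)` ⇒ `U₁U₀ ∈ 𝔄_k({Ω_j}, α₀ + 3L²α₂)`.
[cite: Balaban1985RegularSpaces, Prop. 7 (1.144) p.100, (1.3)-(1.4) p.77] -/
theorem inAk_mulCfg_literal_domainSeq {𝔸 : Type*} [NormedRing 𝔸] [NormOneClass 𝔸] [NormedAlgebra ℂ 𝔸]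
    [CompleteSpace 𝔸] {η : ℝ} (hη : 0 < η) {L : ℕ} (hL : 1 ≤ L) {k : ℕ} {U₀ : Site d → Fin d → 𝔸ˣ}
    (h₀ : ∀ y κ, U₀ y κ ∈ U1 𝔸) {A : Site d → Fin d → 𝔸} (h₁ : ∀ y κ, expCfg (iEta η A) y κ ∈ U1 𝔸)
    {α₀ α₂ : ℝ} (hα₀ : 0 ≤ α₀) (hα₀c : α₀ ≤ 1 / (80 * d)) (hα₂ : 0 ≤ α₂) (hα₂c : (L : ℝ) ^ 2 * α₂ ≤ 1 / (80 * d))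
    {Ω : ℕ → Set (Site d)} (hΩ : DomainSeq L Ω) (hΩ₀ : Ω 0 = Set.univ) (h139 : InAk L k η α₀ Ω U₀)
    (h140 : ∀ j, j ≤ k → Cond140Lit L η α₂ j (Ω j) U₀ A)
    (hu : ∀ j, j ≤ k → ∀ y τ, SideTouches (Ω j) y τ →
      ‖(expCfg (iEta η A) y τ : 𝔸) - 1‖ ≤ (L : ℝ) ^ 2 * α₂ * ((L : ℝ) ^ j * η)⁻¹ * η) :
    InAk L k η (α₀ + 3 * ((L : ℝ) ^ 2 * α₂)) Ω (mulCfg (expCfg (iEta η A)) U₀) :=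
  inAk_mulCfg_literal hη hL h₀ h₁ hα₀ hα₀c hα₂ hα₂c hΩ₀
    (fun i _ => sideTouches_succ_bondTouches_of_domainSeq hL hΩ i) h139 h140 hu

/-- **(1.144) for Hermitian `A` and an admissible family (1.3)/(1.4), (1.140) in the literal convention**:
`U′U₀ = (U₁U₀)^u ∈ 𝔄_k({Ω_j}, α₀ + 3L²α₂)` for every `U1`-valued `u` (`DomainSeq L Ω`, `Ω₀ = T_η`,
`U₀ ∈ 𝔄_k({Ω_j}, α₀)`, `Cond140Lit` at every level, `0 ≤ α₀ ≤ 1/(80d)`, `0 ≤ α₂`, `L²α₂ ≤ 1/(80d)`).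
[cite: Balaban1985RegularSpaces, Prop. 7 (1.144) p.100, (1.3)-(1.4) p.77] -/
theorem inAk_mulCfg_gaugeAct_hermitian_literal_domainSeq {𝔸 : Type*} [CStarAlgebra 𝔸] [Nontrivial 𝔸] {η : ℝ}
    (hη : 0 < η) {L : ℕ} (hL : 1 ≤ L) {k : ℕ} {U₀ : Site d → Fin d → 𝔸ˣ} (h₀ : ∀ y κ, U₀ y κ ∈ U1 𝔸)
    {A : Site d → Fin d → 𝔸} (hAh : ∀ y κ, IsSelfAdjoint (A y κ)) {α₀ α₂ : ℝ} (hα₀ : 0 ≤ α₀)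
    (hα₀c : α₀ ≤ 1 / (80 * d)) (hα₂ : 0 ≤ α₂) (hα₂c : (L : ℝ) ^ 2 * α₂ ≤ 1 / (80 * d)) {Ω : ℕ → Set (Site d)}
    (hΩ : DomainSeq L Ω) (hΩ₀ : Ω 0 = Set.univ) (h139 : InAk L k η α₀ Ω U₀)
    (h140 : ∀ j, j ≤ k → Cond140Lit L η α₂ j (Ω j) U₀ A) {u : Site d → 𝔸ˣ} (hu1 : ∀ x, u x ∈ U1 𝔸) :
    InAk L k η (α₀ + 3 * ((L : ℝ) ^ 2 * α₂)) Ω (gaugeAct u (mulCfg (expCfg (iEta η A)) U₀)) :=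
  inAk_mulCfg_gaugeAct_hermitian_literal hη hL h₀ hAh hα₀ hα₀c hα₂ hα₂c hΩ₀
    (fun i _ => sideTouches_succ_bondTouches_of_domainSeq hL hΩ i) h139 h140 hu1

end ClassAkDomainSeq

#print axioms sideTouches_succ_bondTouches_of_domainSeq
#print axioms inAk_mulCfg_literal_domainSeq
#print axioms inAk_mulCfg_gaugeAct_hermitian_literal_domainSeq

end Literature.MathematicalPhysics.QuantumFieldTheory.Balaban1983to89.B8Prop7ClassAkDomainSeq
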